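import Mathlib
import HarnessLib
import Summits.HubbardSuperconductivity.HubbardSuperconductivity.Theorems.KLProgrammeKLRegimeSplitPredicates

/-!
# Route `KLProgramme` — crux K3, the Counterterm child (gen-3 item stmt-HubbardSuperconductivity-19825 `KLRegimeCountertermV11`):
# the frame distance `frameDist K K′ = sup_p |K(p) − K′(p)|` of (E3c-G) `FrameLipschitzG` — its elementary API
# (seat hubbard-kl-k3c3-p1; consumed by the wholesale continuation's contraction step)

`frameDist` (`…SplitPredicates` §4) is an `iSup` over all momenta; (E3c-G) bounds the pieces by `lipBar n · frameDist K K′`.  The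
continuation (k3c3-p2) needs to pass between POINTWISE bounds and the sup: every trigonometric polynomial is bounded
(`|A(p)| ≤ coeffNorm 0 A`), so the defining family is bounded above and

* `abs_eval_sub_le_frameDist` : `|K(p) − K′(p)| ≤ frameDist K K′`;
* `frameDist_le_of_forall` : `(∀ p, |K(p) − K′(p)| ≤ d) → frameDist K K′ ≤ d`;
* `frameDist_nonneg`, `frameDist_comm`, `frameDist_self`, `frameDist_triangle`, `frameDist_le_coeffNorm`;
* `frameDist_map_le_of_pointwise_lipschitz` : if `|T K (p) − T K′ (p)| ≤ q · frameDist K K′` at every `p` then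
  `frameDist (T K) (T K′) ≤ q · frameDist K K′` — the shape in which (E3c-G) summed over the scales makes the counterterm map a contraction;
* `frameDist_le_of_eval_eq` : frames with the same values are at distance `0` from any common comparison frame.

Proofs only; nothing is asserted about the Hubbard model.
-/

noncomputable section

namespace Summit.HubbardSuperconductivity.HubbardSuperconductivity.Theorems.KLRegimeSplit

set_option linter.dupNamespace false -- summit = problem name (single-conjunct summit), D-0017

open Real Literature.MathematicalPhysics.QuantumLattice

/-- The defining family of `frameDist` is bounded above (by `coeffNorm 0 K + coeffNorm 0 K′`). -/
theorem bddAbove_range_abs_eval_sub (K K' : TrigPolyC4v) :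
    BddAbove (Set.range fun p : Fin 2 → ℝ => |K.eval p - K'.eval p|) := by
  refine ⟨K.coeffNorm 0 + K'.coeffNorm 0, ?_⟩
  rintro x ⟨p, rfl⟩
  have h1 := TrigPolyC4v.abs_eval_le_coeffNorm K p
  have h2 := TrigPolyC4v.abs_eval_le_coeffNorm K' p
  exact (abs_sub _ _).trans (add_le_add h1 h2)

/-- **Pointwise ≤ sup**: `|K(p) − K′(p)| ≤ frameDist K K′`. -/
theorem abs_eval_sub_le_frameDist (K K' : TrigPolyC4v) (p : Fin 2 → ℝ) : |K.eval p - K'.eval p| ≤ frameDist K K' :=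
  le_ciSup (bddAbove_range_abs_eval_sub K K') p

/-- **Sup ≤ uniform pointwise bound**: `(∀ p, |K(p) − K′(p)| ≤ d) → frameDist K K′ ≤ d`. -/
theorem frameDist_le_of_forall {K K' : TrigPolyC4v} {d : ℝ} (h : ∀ p : Fin 2 → ℝ, |K.eval p - K'.eval p| ≤ d) :
    frameDist K K' ≤ d :=
  ciSup_le h

/-- `0 ≤ frameDist K K′`. -/
theorem frameDist_nonneg (K K' : TrigPolyC4v) : 0 ≤ frameDist K K' :=
  (abs_nonneg _).trans (abs_eval_sub_le_frameDist K K' 0)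

/-- `frameDist K K′ ≤ coeffNorm 0 K + coeffNorm 0 K′`. -/
theorem frameDist_le_coeffNorm (K K' : TrigPolyC4v) : frameDist K K' ≤ K.coeffNorm 0 + K'.coeffNorm 0 :=
  frameDist_le_of_forall fun p =>
    (abs_sub _ _).trans (add_le_add (TrigPolyC4v.abs_eval_le_coeffNorm K p) (TrigPolyC4v.abs_eval_le_coeffNorm K' p))

/-- Symmetry. -/
theorem frameDist_comm (K K' : TrigPolyC4v) : frameDist K K' = frameDist K' K := by
  unfold frameDist
  congr 1
  funext p
  rw [abs_sub_comm]

/-- `frameDist K K = 0`. -/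
theorem frameDist_self (K : TrigPolyC4v) : frameDist K K = 0 :=
  le_antisymm (frameDist_le_of_forall fun p => by simp) (frameDist_nonneg K K)

/-- Frames with the same VALUES are at distance `0` (the distance sees `eval` only). -/
theorem frameDist_eq_zero_of_eval_eq {K K' : TrigPolyC4v} (h : ∀ p, K.eval p = K'.eval p) : frameDist K K' = 0 :=
  le_antisymm (frameDist_le_of_forall fun p => by simp [h p]) (frameDist_nonneg K K')

/-- **Triangle inequality.** -/
theorem frameDist_triangle (K K' K'' : TrigPolyC4v) : frameDist K K'' ≤ frameDist K K' + frameDist K' K'' :=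
  frameDist_le_of_forall fun p => by
    have h1 := abs_eval_sub_le_frameDist K K' p
    have h2 := abs_eval_sub_le_frameDist K' K'' p
    calc |K.eval p - K''.eval p| = |(K.eval p - K'.eval p) + (K'.eval p - K''.eval p)| := by ring_nf
      _ ≤ |K.eval p - K'.eval p| + |K'.eval p - K''.eval p| := abs_add_le _ _
      _ ≤ frameDist K K' + frameDist K' K'' := add_le_add h1 h2

/-- The distance is invariant under replacing either frame by one with the same values. -/
theorem frameDist_congr_eval {K₁ K₂ K₁' K₂' : TrigPolyC4v} (h₁ : ∀ p, K₁.eval p = K₁'.eval p) (h₂ : ∀ p, K₂.eval p = K₂'.eval p) :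
    frameDist K₁ K₂ = frameDist K₁' K₂' := by
  unfold frameDist
  congr 1
  funext p
  rw [h₁ p, h₂ p]

/-- **Contraction shape.**  If a map `T` on frames satisfies `|T K (p) − T K′ (p)| ≤ q · frameDist K K′` at every momentum (e.g. (E3c-G)
summed over the scales: `q = Σ_i lipBar G Q U i`), then `frameDist (T K) (T K′) ≤ q · frameDist K K′`. -/
theorem frameDist_map_le_of_pointwise_lipschitz {T : TrigPolyC4v → TrigPolyC4v} {q : ℝ} {K K' : TrigPolyC4v}
    (h : ∀ p : Fin 2 → ℝ, |(T K).eval p - (T K').eval p| ≤ q * frameDist K K') : frameDist (T K) (T K') ≤ q * frameDist K K' :=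
  frameDist_le_of_forall h

/-- **Sum of pointwise-Lipschitz pieces.**  If each `ℓ i` is `lip i · frameDist K K′`-Lipschitz at every momentum, then so is their sum with
constant `Σ lip i`, and the sup distance of the sums is `≤ (Σ_i lip i) · frameDist K K′`. -/
theorem frameDist_sum_le {ι : Type*} (s : Finset ι) {ℓ : TrigPolyC4v → ι → TrigPolyC4v} {lip : ι → ℝ} {K K' : TrigPolyC4v}
    {S S' : TrigPolyC4v} (hS : ∀ p, S.eval p = ∑ i ∈ s, (ℓ K i).eval p) (hS' : ∀ p, S'.eval p = ∑ i ∈ s, (ℓ K' i).eval p)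
    (h : ∀ i ∈ s, ∀ p : Fin 2 → ℝ, |(ℓ K i).eval p - (ℓ K' i).eval p| ≤ lip i * frameDist K K') :
    frameDist S S' ≤ (∑ i ∈ s, lip i) * frameDist K K' :=
  frameDist_le_of_forall fun p => by
    rw [hS p, hS' p, ← Finset.sum_sub_distrib, Finset.sum_mul]
    exact (Finset.abs_sum_le_sum_abs _ _).trans (Finset.sum_le_sum fun i hi => h i hi p)

/-- **Geometric decay of a Picard iteration in `frameDist`.**  If consecutive iterates contract,
`frameDist (T^[m+2] K₀) (T^[m+1] K₀) ≤ q · frameDist (T^[m+1] K₀) (T^[m] K₀)`, then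
`frameDist (T^[m+1] K₀) (T^[m] K₀) ≤ q^m · frameDist (T K₀) K₀`. -/
theorem frameDist_iterate_le {T : TrigPolyC4v → TrigPolyC4v} {q : ℝ} (hq : 0 ≤ q) (K₀ : TrigPolyC4v)
    (h : ∀ m : ℕ, frameDist (T^[m + 2] K₀) (T^[m + 1] K₀) ≤ q * frameDist (T^[m + 1] K₀) (T^[m] K₀)) (m : ℕ) :
    frameDist (T^[m + 1] K₀) (T^[m] K₀) ≤ q ^ m * frameDist (T K₀) K₀ := by
  induction m with
  | zero => simp
  | succ m ih =>
    calc frameDist (T^[m + 1 + 1] K₀) (T^[m + 1] K₀) ≤ q * frameDist (T^[m + 1] K₀) (T^[m] K₀) := h m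
      _ ≤ q * (q ^ m * frameDist (T K₀) K₀) := mul_le_mul_of_nonneg_left ih hq
      _ = q ^ (m + 1) * frameDist (T K₀) K₀ := by ring

/-- **Summed decay**: under the same contraction with `q < 1`, `frameDist (T^[m] K₀) K₀ ≤ frameDist (T K₀) K₀ / (1 − q)` for every `m`
(the whole orbit stays in the ball of radius `d₀/(1−q)` around `K₀`). -/
theorem frameDist_iterate_start_le {T : TrigPolyC4v → TrigPolyC4v} {q : ℝ} (hq : 0 ≤ q) (hq1 : q < 1) (K₀ : TrigPolyC4v)
    (h : ∀ m : ℕ, frameDist (T^[m + 2] K₀) (T^[m + 1] K₀) ≤ q * frameDist (T^[m + 1] K₀) (T^[m] K₀)) (m : ℕ) :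
    frameDist (T^[m] K₀) K₀ ≤ frameDist (T K₀) K₀ / (1 - q) := by
  have hd0 : 0 ≤ frameDist (T K₀) K₀ := frameDist_nonneg _ _
  have h1q : 0 < 1 - q := by linarith
  -- `frameDist (T^[m] K₀) K₀ ≤ Σ_{i<m} q^i · d₀`
  have hsum : ∀ m : ℕ, frameDist (T^[m] K₀) K₀ ≤ (∑ i ∈ Finset.range m, q ^ i) * frameDist (T K₀) K₀ := by
    intro m
    induction m with
    | zero => simp [frameDist_self]
    | succ m ih =>
      calc frameDist (T^[m + 1] K₀) K₀ ≤ frameDist (T^[m + 1] K₀) (T^[m] K₀) + frameDist (T^[m] K₀) K₀ := frameDist_triangle _ _ _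
        _ ≤ q ^ m * frameDist (T K₀) K₀ + (∑ i ∈ Finset.range m, q ^ i) * frameDist (T K₀) K₀ :=
            add_le_add (frameDist_iterate_le hq K₀ h m) ih
        _ = (∑ i ∈ Finset.range (m + 1), q ^ i) * frameDist (T K₀) K₀ := by rw [Finset.sum_range_succ]; ring
  have hgeom : (∑ i ∈ Finset.range m, q ^ i) ≤ 1 / (1 - q) := by
    rw [le_div_iff₀ h1q]
    have hmul := geom_sum_mul_neg q m
    have hqm : 0 ≤ q ^ m := pow_nonneg hq m
    linarith
  calc frameDist (T^[m] K₀) K₀ ≤ (∑ i ∈ Finset.range m, q ^ i) * frameDist (T K₀) K₀ := hsum m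
    _ ≤ (1 / (1 - q)) * frameDist (T K₀) K₀ := mul_le_mul_of_nonneg_right hgeom hd0
    _ = frameDist (T K₀) K₀ / (1 - q) := by ring

end Summit.HubbardSuperconductivity.HubbardSuperconductivity.Theorems.KLRegimeSplit

end
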